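/-
Copyright (c) 2026 the pub-hodgecm-mathlib formalisation cell (harness21).  Prover seat hodgecm-mathlib-K2E3-p28 (g4) (S6 hand under dealer R90-C14-plan (g3)),
card (G2) «TYPE-(2) DISCHARGE», FILE 3 = the DEEP regime (`2 ≤ n`, `1 ≤ N`) of the RECORD target (E2) at every displacement `m`, HYPOTHESIS-FREE (dealer (R27)
2026-09-05T03:43:23Z: `hU1` := ★ (R2) + (G2-ODD) C + Theorem 18 at `(n−2, N−1)`).  THEOREMS ONLY (no `def`, no `instance`, no notation, no named-fact hypothesis, no `sorry`);
lane `--supports stmt-HodgeConjecture-24833 --as helper` (count-neutral helper).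
-/
import Summits.HodgeConjecture.HodgeConjecture.Theorems.R90S6EllipticIdentityTypeTwo                 -- ★ FILE 2 p865259 (this seat): `…_of_unitLevelOne`, `typeTwo_exponent_law`, `log_v_typeTwo_eq_neg`, `phiHtwo_cast_eq_sum`, `one_lt_of_card_residueField_eq_sq`; brings FILE 1b, ★ a₀, ★ `flicker_theorem18n_halg`, ★ `unitaryInt_eq_glInt_subgroupOf`
import Summits.HodgeConjecture.HodgeConjecture.Theorems.R90S6TorusFixedSpecialCountClosedForm       -- ★ (R2) p864xxx (p07) `natCard_fixedBy_special_add_phiTHn_eq_of_typeTwo` (EVEN class special count, deep)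
import Summits.HodgeConjecture.HodgeConjecture.Theorems.R90S6TorusFixedSpecialCountTypeTwoOdd        -- (G2-ODD) C (p07) `natCard_fixedBy_special_add_phiTHprimen_eq_of_typeTwo_odd` (ODD class special count, deep)
import Literature.NumberTheory.Automorphic.UnitaryLatticeTreeLevelIndices                            -- ★ `index_inf_subgroupOf_eq_of_unramified` (`[K₀ : K₀ ⊓ K₁] = q³ + 1` ⇒ the (R2) fibre instance)
import Literature.NumberTheory.Automorphic.UnitaryLatticeTreeRootStarCount                           -- ★ V4 `ncard_neighborSet_of_isSelfDualLattice` (`#star(L₀) = q³ + 1`)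
import HarnessLib

/-!
# R90 · S6 — row E1.3.5.2.6, card (G2) FILE 3: THE RAMIFIED TYPE-(2) ELLIPTIC κ-IDENTITY (E2) IN THE DEEP REGIME, HYPOTHESIS-FREE
# (`Theorems/R90S6EllipticIdentityTypeTwoDeep.lean`)

Cell `hodgecm-mathlib`, crux H413 (`stmt-HodgeConjecture-24833`), route of record `HCCMUnconditional`; programme R90-TF, section S6 (base `R90-C14`, dealer
R90-C14-plan (g3)), seat K2E3-p28 (g4); card **(G2) «TYPE-(2) DISCHARGE»**, RECORD target (E2) = typ1 sheet v2.3 `4c174fca74d7a58a` :468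
`delta_mul_kappaDiff_ncard_displaced_typeTwo_eq_sum_xiHCoeff_mul_ncard_displaced_two` ([BR₁] Thm. 1 = Rogawski Prop. 4.9.1 (b) for the ramified anisotropic torus
`T ≃ E¹ × Res M¹`; Flicker 1998 Theorem 18 at `m = 0`).

THE MATHEMATICS.  ★ FILE 2 proved (E2) at every `m` from ONE named anchor (U1₂) `Δ·(V₁(γ₁) − V₁(γ₂)) = Σ_{k≤N} q^k − 1` (`V₁ = #Fix(U₃ ⧸ K₁)` the fixed SPECIAL vertices,
`Δ = (−q)^{−n}`).  In the DEEP regime `2 ≤ n`, `1 ≤ N` the anchor is «Theorem 18 one level down» (§1): by ★ (R2) (even class, at the literal `γ₁` with its even eigenvector `e₁`)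
and (G2-ODD) C (odd class, at the intrinsic letters `hγ₂x hx₂ hN₂ hn₂`) — both Kottwitz's Cayley shift `Y` with exponents `(n−2, N−1)` through ★ rung 1 — `V₁(γᵢ) + Φᵢ = 1 + S·Φᵢ`
with `Φ₁ = phiTHn q (n−2) (N−1)`, `Φ₂ = phiTHprimen q (n−2) (N−1)` and `S = #star(L₀) = q³ + 1` (★ V4 `ncard_neighborSet_of_isSelfDualLattice`); so
`V₁(γ₁) − V₁(γ₂) = q³·(Φ₁ − Φ₂) = q³·(−q)^{n−2}·Φ_H(N−1)` (★ `flicker_theorem18n_halg` at `(n−2, N−1)`, whose law follows from §1 of ★ FILE 2, `typeTwo_exponent_law`), and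
`Δ·q³·(−q)^{n−2}·Φ_H(N−1) = q·Φ_H(N−1) = q·Σ_{k≤N−1} q^k = Σ_{k≤N} q^k − 1`.  The two extra binders of ★ (R2) ∕ C — the section `r` of `U₃ → U₃ ⧸ K₀` and the finiteness of the
fibres `Fix(K₀ ⧸ (K₀ ⊓ K₁))` — are BUILT here (`Quotient.out`, and `[K₀ : K₀ ⊓ K₁] = q³ + 1 < ∞` ★ `index_inf_subgroupOf_eq_of_unramified`), the `Fintype` of `Fix(U₃ ⧸ K₀)` from `hfin₀ᵢ`,
`1 < q` and `#𝓀 = q²` as `Nat.card` from `[Fintype 𝓀] hq` (dealer ruling (Q2): built downstream, not letters).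
HEAD `…_of_deep`: (E2) :468's binders VERBATIM and in order minus the H-side root `x₀ hx₀` (unused: ★ HF2's counts are root-free), conclusion BYTES VERBATIM, NO named
hypothesis: ★ FILE 2 `…_of_unitLevelOne` ∘ §1.
HONEST LABEL: (E2) in the deep regime for all `m`, sorry-free and hypothesis-free over ★ organs; the shallow regime (E2♭) still waits on K2Liu-p14's «E2♭-COUNT» special counts
(FILE 3♭).  Proves no printed global statement by itself, discharges no citation, count-neutral until E1.3.5.2 ∕ E1.3.9 consume it.  HC_CM is proved only modulo the 7 printed
citations (2 remaining named inputs: hLiu418 = stmt-HodgeConjecture-24832, h413 = stmt-HodgeConjecture-24833) until rung 0 closes.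

## References
* [Rogawski1990] J. D. Rogawski, *Automorphic Representations of Unitary Groups in Three Variables*, Ann. of Math. Stud. 123 (1990), §4.9 Prop. 4.9.1 (b) pp. 54–55;
  §3.6 Lemma 3.6.1 p. 28.
* [Flicker1998UnitaryFL] Y. Z. Flicker, *Elementary proof of the fundamental lemma for a unitary group*, Canad. J. Math. 50 (1998), Prop. 11 p. 87, Props. 16–17
  pp. 96–97, Theorem 18 p. 97.
* [Kottwitz1986BaseChangeUnits] R. E. Kottwitz, *Base change for unit elements of Hecke algebras*, Compositio Math. 60 (1986), §1 pp. 240–241 (the Cayley shift).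
* [Kottwitz1988] R. E. Kottwitz, *Tamagawa numbers*, Ann. of Math. 127 (1988), §2.  [Tits1979] J. Tits, *Reductive groups over local fields*, PSPM 33.1 (1979), §2.4, §3.3.3.
-/

set_option autoImplicit false
-- the mandated namespace repeats the single-problem summit's segment (`HodgeConjecture.HodgeConjecture`)
set_option linter.dupNamespace false

noncomputable section

open MulAction Finset
open scoped Valued WithZero Matrix MatrixGroups
open Literature.NumberTheory.Automorphic Literature.NumberTheory.Automorphic.HermitianLattice Literature.NumberTheory.Automorphic.UnitaryGroup
open Literature.NumberTheory.Automorphic.UnitaryLatticeTree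
open Literature.NumberTheory.Rogawski1990.Flicker1998 (phiTHn phiTHprimen phiHtwo flicker_theorem18n_halg)
open IsLocalRing

namespace Summit.HodgeConjecture.HodgeConjecture.R90.S6

variable {K : Type} [Field K] [Valued K ℤᵐ⁰] [ValuativeRel K] [(Valued.v : Valuation K ℤᵐ⁰).Compatible] {σ : K →+* K} {ϖ : K}

/-! ## §1 The level-one anchor (U1₂) in the deep regime: Theorem 18 one level down -/

set_option synthInstance.maxHeartbeats 400000 in
set_option maxHeartbeats 1600000 in
-- the subgroup-quotient carriers `U₃ ⧸ K₀`, `U₃ ⧸ K₁`, `K₀ ⧸ (K₀ ⊓ K₁)` and ★ a₀'s frame term are slow to elaborate (same budgets as ★ (R2) ∕ C)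
/-- **(U1₂) PAID IN THE DEEP REGIME (`2 ≤ n`, `1 ≤ N`)**: `(−q)^{log|(u−A)² − C²ρ|}·(#Fix_{γ₁}(U₃ ⧸ K₁) − #Fix_{γ₂}(U₃ ⧸ K₁)) = Σ_{k ≤ N} q^k − 1` — ★ (R2) (even class at
the literal `γ₁`, eigenvector `e₁`) and (G2-ODD) C (odd class, intrinsic letters) give `V₁(γᵢ) + Φᵢ = 1 + (q³+1)·Φᵢ` (`Φ₁ = phiTHn`, `Φ₂ = phiTHprimen` at `(n−2, N−1)`, `S = q³ + 1`
★ V4); ★ `flicker_theorem18n_halg` at `(n−2, N−1)` (law from ★ `typeTwo_exponent_law`) and `q·Φ_H(N−1) = Σ_{k≤N} q^k − 1`.  The section `r` and the fibre finiteness of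
★ (R2) ∕ C are built (`Quotient.out`; `[K₀ : K₀ ⊓ K₁] = q³ + 1`). [cite: Flicker1998UnitaryFL, Theorem 18 p. 97; Prop. 11 p. 87; Prop. 17 p. 97]
[cite: Kottwitz1986BaseChangeUnits, §1 pp. 240–241] [cite: Kottwitz1988, §2] [cite: Rogawski1990, §4.9 Prop. 4.9.1 (b) p. 55] -/
theorem delta_mul_natCard_fixedBy_special_sub_eq_of_typeTwo_deep (hd : HermitianLattice.LocalConjDatum σ ϖ)
    (hσO : ∀ x : 𝒪[K], σ x ∈ 𝒪[K]) (σk : 𝓀[K] →+* 𝓀[K])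
    (hσk : ∀ x : 𝒪[K], IsLocalRing.residue 𝒪[K] ⟨σ x, hσO x⟩ = σk (IsLocalRing.residue 𝒪[K] x))
    [Fintype 𝓀[K]] {q : ℕ} (hq : Fintype.card 𝓀[K] = q ^ 2) (hfrob : ∀ y, σk y = y ^ q)
    {A C ρ u : K} (hvρ : Valued.v ρ = Valued.v ϖ) {N n : ℕ} (hvC : Valued.v C = Valued.v (ϖ ^ N))
    (hχ : Valued.v ((u - A) ^ 2 - C ^ 2 * ρ) = Valued.v (ϖ ^ n)) (hn2 : 2 ≤ n) (hN1 : 1 ≤ N)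
    (γ₁ : unitaryGroupOfForm σ ((StdForm.antidiagonal 3).over K))
    (hγ₁ : ((γ₁ : GL (Fin 3) K) : Matrix (Fin 3) (Fin 3) K) = !![A, 0, C * ρ; 0, u, 0; C, 0, A])
    (γ₂ : unitaryGroupOfForm σ ((StdForm.antidiagonal 3).over K))
    {x₂ : Fin 3 → K} (hγ₂x : ((γ₂ : GL (Fin 3) K) : Matrix (Fin 3) (Fin 3) K) *ᵥ x₂ = u • x₂)
    {k₂ : ℤ} (hx₂ : Valued.v (HermitianLattice.B₀ σ 3 x₂ x₂) = WithZero.exp (2 * k₂ + 1))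
    (hN₂ : Valued.v ((Matrix.trace ((γ₂ : GL (Fin 3) K) : Matrix (Fin 3) (Fin 3) K) - u) ^ 2 -
      4 * (Matrix.det ((γ₂ : GL (Fin 3) K) : Matrix (Fin 3) (Fin 3) K) / u)) = Valued.v (ϖ ^ (2 * N + 1)))
    (hn₂ : Valued.v (u ^ 2 - (Matrix.trace ((γ₂ : GL (Fin 3) K) : Matrix (Fin 3) (Fin 3) K) - u) * u +
      Matrix.det ((γ₂ : GL (Fin 3) K) : Matrix (Fin 3) (Fin 3) K) / u) = Valued.v (ϖ ^ n))
    [IsDiscreteValuationRing 𝒪[K]] [IsAdicComplete (IsLocalRing.maximalIdeal 𝒪[K]) 𝒪[K]]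
    {y : K} (hy : y * σ y = -2)
    {cW : ↥(unitaryGroupOfForm σ ((StdForm.antidiagonal 3).over K))} (hcW : ((cW : GL (Fin 3) K) : Matrix (Fin 3) (Fin 3) K) = !![1, 0, 0; 0, -1, 0; 0, 0, 1])
    (um : ℕ → ↥(unitaryGroupOfForm σ ((StdForm.antidiagonal 3).over K)))
    (hum : ∀ m, ((um m : GL (Fin 3) K) : Matrix (Fin 3) (Fin 3) K) = !![ϖ ^ m, y, (ϖ ^ m)⁻¹; 0, 1, -σ y * (ϖ ^ m)⁻¹; 0, 0, (ϖ ^ m)⁻¹])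
    {R : Type} [CommRing R] [IsDomain R] [IsDiscreteValuationRing R] [Finite (IsLocalRing.ResidueField R)] [IsAdicComplete (IsLocalRing.maximalIdeal R) R]
    (ι : R →+* K) (hι : Function.Injective ι)
    (hιv : ∀ x : K, Valued.v x ≤ 1 ↔ x ∈ Set.range ι) (σR : R →+* R) (hσR : ∀ r, σR (σR r) = r) (hσι : ∀ r, ι (σR r) = σ (ι r))
    {dR : R} (hdRσ : σR dR = -dR) (hdRu : IsUnit dR) (h2R : IsUnit (2 : R)) {ϖR : R} (hϖR : Irreducible ϖR) (hιϖ : ι ϖR = ϖ)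
    (hqR : Nat.card (IsLocalRing.ResidueField R) = q ^ 2)
    {a₀ : 𝒪[K]} (ha₀ : IsUnit (((σ.comp 𝒪[K].subtype).codRestrict 𝒪[K] hσO) a₀ - a₀))
    (g₁ : GL (Fin 3) K) (hg₁ : (g₁ : Matrix (Fin 3) (Fin 3) K) = Matrix.diagonal ![(1 : K), 1, ϖ])
    (hfin₀₁ : (fixedBy (↥(unitaryGroupOfForm σ ((StdForm.antidiagonal 3).over K)) ⧸
      (glInt 3 K).subgroupOf (unitaryGroupOfForm σ ((StdForm.antidiagonal 3).over K))) γ₁).Finite)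
    (hfin₁₁ : (fixedBy (↥(unitaryGroupOfForm σ ((StdForm.antidiagonal 3).over K)) ⧸
      ((glInt 3 K).map (MulAut.conj g₁).toMonoidHom).subgroupOf (unitaryGroupOfForm σ ((StdForm.antidiagonal 3).over K))) γ₁).Finite)
    (horb₁ : (Set.range fun n : ℕ => ((γ₁ ^ n : ↥(unitaryGroupOfForm σ ((StdForm.antidiagonal 3).over K))) :
      ↥(unitaryGroupOfForm σ ((StdForm.antidiagonal 3).over K)) ⧸ (glInt 3 K).subgroupOf (unitaryGroupOfForm σ ((StdForm.antidiagonal 3).over K)))).Finite)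
    (hfin₀₂ : (fixedBy (↥(unitaryGroupOfForm σ ((StdForm.antidiagonal 3).over K)) ⧸
      (glInt 3 K).subgroupOf (unitaryGroupOfForm σ ((StdForm.antidiagonal 3).over K))) γ₂).Finite)
    (hfin₁₂ : (fixedBy (↥(unitaryGroupOfForm σ ((StdForm.antidiagonal 3).over K)) ⧸
      ((glInt 3 K).map (MulAut.conj g₁).toMonoidHom).subgroupOf (unitaryGroupOfForm σ ((StdForm.antidiagonal 3).over K))) γ₂).Finite)
    (horb₂ : (Set.range fun n : ℕ => ((γ₂ ^ n : ↥(unitaryGroupOfForm σ ((StdForm.antidiagonal 3).over K))) :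
      ↥(unitaryGroupOfForm σ ((StdForm.antidiagonal 3).over K)) ⧸ (glInt 3 K).subgroupOf (unitaryGroupOfForm σ ((StdForm.antidiagonal 3).over K)))).Finite) :
    (-(q : ℂ)) ^ WithZero.log (Valued.v ((u - A) ^ 2 - C ^ 2 * ρ)) *
        ((Nat.card (fixedBy (↥(unitaryGroupOfForm σ ((StdForm.antidiagonal 3).over K)) ⧸
            ((glInt 3 K).map (MulAut.conj g₁).toMonoidHom).subgroupOf (unitaryGroupOfForm σ ((StdForm.antidiagonal 3).over K))) γ₁) : ℂ) -
          (Nat.card (fixedBy (↥(unitaryGroupOfForm σ ((StdForm.antidiagonal 3).over K)) ⧸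
            ((glInt 3 K).map (MulAut.conj g₁).toMonoidHom).subgroupOf (unitaryGroupOfForm σ ((StdForm.antidiagonal 3).over K))) γ₂) : ℂ)) =
      ((∑ k ∈ Finset.range (N + 1), q ^ k : ℕ) : ℂ) - 1 := by
  classical
  have hq1 : 1 < q := one_lt_of_card_residueField_eq_sq hq
  have hqNat : Nat.card (IsLocalRing.ResidueField 𝒪[K]) = q ^ 2 := by rw [Nat.card_eq_fintype_card]; exact hq
  have hlaw := typeTwo_exponent_law hd hvρ hvC hχ
  -- the built binders of ★ (R2) ∕ C: `Fintype (Fix(U₃ ⧸ K₀))`, the section `r`, the fibre finiteness (`[K₀ : K₀ ⊓ K₁] = q³ + 1`)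
  haveI : Fintype (fixedBy (↥(unitaryGroupOfForm σ ((StdForm.antidiagonal 3).over K)) ⧸
      (glInt 3 K).subgroupOf (unitaryGroupOfForm σ ((StdForm.antidiagonal 3).over K))) γ₁) := hfin₀₁.fintype
  haveI : Fintype (fixedBy (↥(unitaryGroupOfForm σ ((StdForm.antidiagonal 3).over K)) ⧸
      (glInt 3 K).subgroupOf (unitaryGroupOfForm σ ((StdForm.antidiagonal 3).over K))) γ₂) := hfin₀₂.fintype
  haveI : (((glInt 3 K).subgroupOf (unitaryGroupOfForm σ ((StdForm.antidiagonal 3).over K)) ⊓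
      ((glInt 3 K).map (MulAut.conj g₁).toMonoidHom).subgroupOf (unitaryGroupOfForm σ ((StdForm.antidiagonal 3).over K))).subgroupOf
      ((glInt 3 K).subgroupOf (unitaryGroupOfForm σ ((StdForm.antidiagonal 3).over K)))).FiniteIndex :=
    ⟨by rw [(index_inf_subgroupOf_eq_of_unramified hd.toUnramified hσO σk hσk hq hfrob g₁ hg₁).1]; exact Nat.succ_ne_zero _⟩
  haveI : Finite (↥((glInt 3 K).subgroupOf (unitaryGroupOfForm σ ((StdForm.antidiagonal 3).over K))) ⧸
      (((glInt 3 K).subgroupOf (unitaryGroupOfForm σ ((StdForm.antidiagonal 3).over K)) ⊓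
        ((glInt 3 K).map (MulAut.conj g₁).toMonoidHom).subgroupOf (unitaryGroupOfForm σ ((StdForm.antidiagonal 3).over K))).subgroupOf
        ((glInt 3 K).subgroupOf (unitaryGroupOfForm σ ((StdForm.antidiagonal 3).over K))))) :=
    Subgroup.finite_quotient_of_finiteIndex
  set r : ↥(unitaryGroupOfForm σ ((StdForm.antidiagonal 3).over K)) ⧸ (glInt 3 K).subgroupOf (unitaryGroupOfForm σ ((StdForm.antidiagonal 3).over K)) →
      ↥(unitaryGroupOfForm σ ((StdForm.antidiagonal 3).over K)) := Quotient.out with hrdef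
  have hr : Function.RightInverse r QuotientGroup.mk := fun z => Quotient.out_eq z
  -- the star of the hyperspecial root: `S = q³ + 1` (★ V4)
  have hS : ((latticeGraph σ ϖ ((StdForm.antidiagonal 3).over K)).neighborSet ⟨stdLattice K 3, 0, isSelfDualLattice_stdLattice_three hd.toUnramified⟩).ncard = q ^ 3 + 1 :=
    ncard_neighborSet_of_isSelfDualLattice hd.toUnramified hσO σk hσk hq hfrob _ (isSelfDualLattice_stdLattice_three hd.toUnramified)
  -- the even class (★ (R2)) at the literal `γ₁`, eigenvector `e₁`
  have htx₁ : ((γ₁ : GL (Fin 3) K) : Matrix (Fin 3) (Fin 3) K) *ᵥ Pi.single 1 1 = u • Pi.single 1 1 := by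
    rw [hγ₁]; ext i; fin_cases i <;> simp [Matrix.mulVec, dotProduct, Pi.single_apply]
  have hx₁ : Valued.v (HermitianLattice.B₀ σ 3 (Pi.single 1 (1 : K)) (Pi.single 1 1)) = WithZero.exp (2 * (0 : ℤ)) := by
    rw [HermitianLattice.B₀_single_left, show Fin.rev (1 : Fin 3) = 1 from rfl, Pi.single_eq_same, map_one, mul_zero, WithZero.exp_zero]
  have hB0₁ : HermitianLattice.B₀ σ 3 (Pi.single 1 (1 : K)) (Pi.single 1 1) ≠ 0 := fun h0 => by
    rw [h0, map_zero] at hx₁; exact WithZero.coe_ne_zero hx₁.symm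
  have hu1 : σ u * u = 1 := map_mul_self_eq_one_of_mulVec_eq_smul σ rfl γ₁ htx₁ hB0₁
  have hu0 : u ≠ 0 := fun h0 => by rw [h0, mul_zero] at hu1; exact zero_ne_one hu1
  have htr₁ : Matrix.trace ((γ₁ : GL (Fin 3) K) : Matrix (Fin 3) (Fin 3) K) = 2 * A + u := by
    rw [hγ₁]
    simp [Matrix.trace_fin_three]
    ring
  have hdet₁ : Matrix.det ((γ₁ : GL (Fin 3) K) : Matrix (Fin 3) (Fin 3) K) = u * (A ^ 2 - C ^ 2 * ρ) := by
    rw [hγ₁]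
    simp [Matrix.det_fin_three]
    ring
  obtain ⟨hdisc₁, heval₁⟩ := v_disc_and_v_eval_of_ramifiedTorus σ hd hu0 hvρ htr₁ hdet₁
  have hvρ' : Valued.v ρ = WithZero.exp (-1 : ℤ) := by rw [hvρ, hd.vϖ]
  have hN₁ : Valued.v ((Matrix.trace ((γ₁ : GL (Fin 3) K) : Matrix (Fin 3) (Fin 3) K) - u) ^ 2 -
      4 * (Matrix.det ((γ₁ : GL (Fin 3) K) : Matrix (Fin 3) (Fin 3) K) / u)) = Valued.v (ϖ ^ (2 * N + 1)) := by
    rw [hdisc₁, hvC, ← map_pow, ← map_mul]; congr 1; ring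
  have hn₁ : Valued.v (u ^ 2 - (Matrix.trace ((γ₁ : GL (Fin 3) K) : Matrix (Fin 3) (Fin 3) K) - u) * u +
      Matrix.det ((γ₁ : GL (Fin 3) K) : Matrix (Fin 3) (Fin 3) K) / u) = Valued.v (ϖ ^ n) := by
    rw [heval₁, ← hχ, show (u - A) ^ 2 - C ^ 2 * ρ = (u - A) ^ 2 - ρ * C ^ 2 by ring, v_sq_sub_mul_sq_eq_max hvρ', hd.vϖ]
  have hR2 := natCard_fixedBy_special_add_phiTHn_eq_of_typeTwo hd g₁ hg₁ γ₁ hfin₁₁ horb₁ r hr hσO hy hcW um hum ι hι hιv σR hσR hσι hdRσ hdRu h2R hϖR hιϖ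
    hqNat hqR hq1 ha₀ htx₁ hx₁ hN₁ hn₁ hn2 hN1
  -- the odd class ((G2-ODD) C), intrinsic letters
  have hCodd := natCard_fixedBy_special_add_phiTHprimen_eq_of_typeTwo_odd hd g₁ hg₁ γ₂ hfin₁₂ horb₂ r hr hσO hqNat hq1 ha₀ hγ₂x hx₂ hN₂ hn₂ hn2 hN1
  rw [hS] at hR2 hCodd
  push_cast at hR2 hCodd
  -- Theorem 18 at `(n − 2, N − 1)`
  have h18 := flicker_theorem18n_halg hq1 (n := n - 2) (N := N - 1) (by omega) (by
    rcases hlaw.2 with he | he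
    · left
      obtain ⟨j, hj⟩ := he
      exact ⟨j - 1, by omega⟩
    · right; omega)
  have hsum : ((∑ k ∈ Finset.range (N + 1), q ^ k : ℕ) : ℂ) - 1 = (q : ℂ) * ((∑ k ∈ Finset.range (N - 1 + 1), q ^ k : ℕ) : ℂ) := by
    rw [Nat.sub_add_cancel hN1, Finset.sum_range_succ', pow_zero]
    push_cast
    rw [Finset.mul_sum]
    simp_rw [pow_succ]
    ring
  have hq0' : (q : ℂ) ≠ 0 := by exact_mod_cast (by omega : q ≠ 0)
  have hq0 : (-(q : ℂ)) ≠ 0 := neg_ne_zero.2 hq0'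
  have hΔ : (-(q : ℂ)) ^ WithZero.log (Valued.v ((u - A) ^ 2 - C ^ 2 * ρ)) = (-(q : ℂ)) ^ (-((n - 2 : ℕ) : ℤ)) * ((q : ℂ) ^ 2)⁻¹ := by
    rw [log_v_typeTwo_eq_neg hd hχ, show (-(n : ℤ)) = -((n - 2 : ℕ) : ℤ) + (-2 : ℤ) by omega, zpow_add₀ hq0]
    congr 1
    rw [show ((-2 : ℤ)) = -((2 : ℕ) : ℤ) by norm_num, zpow_neg, zpow_natCast, neg_sq]
  -- the two special counts as complex numbers
  have e1 : ((Nat.card (fixedBy (↥(unitaryGroupOfForm σ ((StdForm.antidiagonal 3).over K)) ⧸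
      ((glInt 3 K).map (MulAut.conj g₁).toMonoidHom).subgroupOf (unitaryGroupOfForm σ ((StdForm.antidiagonal 3).over K))) γ₁) : ℕ) : ℂ) =
      1 + (q : ℂ) ^ 3 * ((phiTHn q (n - 2) (N - 1) : ℚ) : ℂ) := by
    have h := congrArg (fun x : ℚ => (x : ℂ)) hR2
    push_cast at h
    linear_combination h
  have e2 : ((Nat.card (fixedBy (↥(unitaryGroupOfForm σ ((StdForm.antidiagonal 3).over K)) ⧸
      ((glInt 3 K).map (MulAut.conj g₁).toMonoidHom).subgroupOf (unitaryGroupOfForm σ ((StdForm.antidiagonal 3).over K))) γ₂) : ℕ) : ℂ) =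
      1 + (q : ℂ) ^ 3 * ((phiTHprimen q (n - 2) (N - 1) : ℚ) : ℂ) := by
    have h := congrArg (fun x : ℚ => (x : ℂ)) hCodd
    push_cast at h
    linear_combination h
  rw [e1, e2, hsum, ← phiHtwo_cast_eq_sum hq1 (N - 1), ← h18, hΔ]
  generalize (-(q : ℂ)) ^ (-((n - 2 : ℕ) : ℤ)) = T
  field_simp
  ring

/-! ## §2 HEAD: (E2) in the deep regime at every displacement, hypothesis-free -/

set_option synthInstance.maxHeartbeats 400000 in
set_option maxHeartbeats 1600000 in
-- same carriers as §1
/-- **(G2) THE RAMIFIED TYPE-(2) ELLIPTIC κ-IDENTITY (E2), DEEP REGIME, AT EVERY `m` — HYPOTHESIS-FREE.**  Binders = the RECORD head typ1 v2.3 :468's own, VERBATIM and in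
its order (`hn2 : 2 ≤ n`, `hN1 : 1 ≤ N` now USED), minus the H-side root `x₀ hx₀` (unused); conclusion = :468's conclusion BYTES VERBATIM.  Proof: ★ FILE 2
`…_of_unitLevelOne` with its one anchor `hU1` := §1.  `Δ‴(γ_H, γ)·Φ^κ(γ, φ_m) = Φ^{st}(γ_H, ξ̂_H φ_m)` for the torus `T ≃ E¹ × Res M¹` at every depth `2 ≤ n ≤ 2N + 1`.
[cite: Rogawski1990, §4.9 Prop. 4.9.1 (b) pp. 54–55; §3.6 Lemma 3.6.1 p. 28] [cite: Flicker1998UnitaryFL, Theorem 18 p. 97; Prop. 11 p. 87; Props. 16–17 pp. 96–97]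
[cite: Kottwitz1986BaseChangeUnits, §1 pp. 240–241] [cite: LabesseLanglands1979, §§2–3] -/
theorem delta_mul_kappaDiff_ncard_displaced_typeTwo_eq_sum_xiHCoeff_mul_ncard_displaced_two_of_deep
    (hd : HermitianLattice.LocalConjDatum σ ϖ)
    (hσO : ∀ x : 𝒪[K], σ x ∈ 𝒪[K]) (σk : 𝓀[K] →+* 𝓀[K])
    (hσk : ∀ x : 𝒪[K], IsLocalRing.residue 𝒪[K] ⟨σ x, hσO x⟩ = σk (IsLocalRing.residue 𝒪[K] x))
    [Fintype 𝓀[K]] {q : ℕ} (hq : Fintype.card 𝓀[K] = q ^ 2) (hfrob : ∀ y, σk y = y ^ q)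
    {A C ρ u : K} (hvρ : Valued.v ρ = Valued.v ϖ) {N n : ℕ} (hvC : Valued.v C = Valued.v (ϖ ^ N))
    (hχ : Valued.v ((u - A) ^ 2 - C ^ 2 * ρ) = Valued.v (ϖ ^ n)) (hn2 : 2 ≤ n) (hN1 : 1 ≤ N)
    (γ₁ : unitaryGroupOfForm σ ((StdForm.antidiagonal 3).over K))
    (hγ₁ : ((γ₁ : GL (Fin 3) K) : Matrix (Fin 3) (Fin 3) K) = !![A, 0, C * ρ; 0, u, 0; C, 0, A])
    (γ₂ : unitaryGroupOfForm σ ((StdForm.antidiagonal 3).over K))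
    {x₂ : Fin 3 → K} (hγ₂x : ((γ₂ : GL (Fin 3) K) : Matrix (Fin 3) (Fin 3) K) *ᵥ x₂ = u • x₂)
    {k₂ : ℤ} (hx₂ : Valued.v (HermitianLattice.B₀ σ 3 x₂ x₂) = WithZero.exp (2 * k₂ + 1))
    (hN₂ : Valued.v ((Matrix.trace ((γ₂ : GL (Fin 3) K) : Matrix (Fin 3) (Fin 3) K) - u) ^ 2 -
      4 * (Matrix.det ((γ₂ : GL (Fin 3) K) : Matrix (Fin 3) (Fin 3) K) / u)) = Valued.v (ϖ ^ (2 * N + 1)))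
    (hn₂ : Valued.v (u ^ 2 - (Matrix.trace ((γ₂ : GL (Fin 3) K) : Matrix (Fin 3) (Fin 3) K) - u) * u +
      Matrix.det ((γ₂ : GL (Fin 3) K) : Matrix (Fin 3) (Fin 3) K) / u) = Valued.v (ϖ ^ n))
    (δ : unitaryGroupOfForm σ ((StdForm.antidiagonal 2).over K))
    (hδ : ((δ : GL (Fin 2) K) : Matrix (Fin 2) (Fin 2) K) = !![A, C * ρ; C, A])
    [IsDiscreteValuationRing 𝒪[K]] [IsAdicComplete (IsLocalRing.maximalIdeal 𝒪[K]) 𝒪[K]]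
    {y : K} (hy : y * σ y = -2)
    {cW : ↥(unitaryGroupOfForm σ ((StdForm.antidiagonal 3).over K))} (hcW : ((cW : GL (Fin 3) K) : Matrix (Fin 3) (Fin 3) K) = !![1, 0, 0; 0, -1, 0; 0, 0, 1])
    (um : ℕ → ↥(unitaryGroupOfForm σ ((StdForm.antidiagonal 3).over K)))
    (hum : ∀ m, ((um m : GL (Fin 3) K) : Matrix (Fin 3) (Fin 3) K) = !![ϖ ^ m, y, (ϖ ^ m)⁻¹; 0, 1, -σ y * (ϖ ^ m)⁻¹; 0, 0, (ϖ ^ m)⁻¹])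
    {R : Type} [CommRing R] [IsDomain R] [IsDiscreteValuationRing R] [Finite (IsLocalRing.ResidueField R)] [IsAdicComplete (IsLocalRing.maximalIdeal R) R]
    (ι : R →+* K) (hι : Function.Injective ι)
    (hιv : ∀ x : K, Valued.v x ≤ 1 ↔ x ∈ Set.range ι) (σR : R →+* R) (hσR : ∀ r, σR (σR r) = r) (hσι : ∀ r, ι (σR r) = σ (ι r))
    {dR : R} (hdRσ : σR dR = -dR) (hdRu : IsUnit dR) (h2R : IsUnit (2 : R)) {ϖR : R} (hϖR : Irreducible ϖR) (hιϖ : ι ϖR = ϖ)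
    (hqR : Nat.card (IsLocalRing.ResidueField R) = q ^ 2)
    {a₀ : 𝒪[K]} (ha₀ : IsUnit (((σ.comp 𝒪[K].subtype).codRestrict 𝒪[K] hσO) a₀ - a₀))
    (g₁ : GL (Fin 3) K) (hg₁ : (g₁ : Matrix (Fin 3) (Fin 3) K) = Matrix.diagonal ![(1 : K), 1, ϖ])
    (hfin₀₁ : (fixedBy (↥(unitaryGroupOfForm σ ((StdForm.antidiagonal 3).over K)) ⧸
      (glInt 3 K).subgroupOf (unitaryGroupOfForm σ ((StdForm.antidiagonal 3).over K))) γ₁).Finite)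
    (hfin₁₁ : (fixedBy (↥(unitaryGroupOfForm σ ((StdForm.antidiagonal 3).over K)) ⧸
      ((glInt 3 K).map (MulAut.conj g₁).toMonoidHom).subgroupOf (unitaryGroupOfForm σ ((StdForm.antidiagonal 3).over K))) γ₁).Finite)
    (horb₁ : (Set.range fun n : ℕ => ((γ₁ ^ n : ↥(unitaryGroupOfForm σ ((StdForm.antidiagonal 3).over K))) :
      ↥(unitaryGroupOfForm σ ((StdForm.antidiagonal 3).over K)) ⧸ (glInt 3 K).subgroupOf (unitaryGroupOfForm σ ((StdForm.antidiagonal 3).over K)))).Finite)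
    (hfin₀₂ : (fixedBy (↥(unitaryGroupOfForm σ ((StdForm.antidiagonal 3).over K)) ⧸
      (glInt 3 K).subgroupOf (unitaryGroupOfForm σ ((StdForm.antidiagonal 3).over K))) γ₂).Finite)
    (hfin₁₂ : (fixedBy (↥(unitaryGroupOfForm σ ((StdForm.antidiagonal 3).over K)) ⧸
      ((glInt 3 K).map (MulAut.conj g₁).toMonoidHom).subgroupOf (unitaryGroupOfForm σ ((StdForm.antidiagonal 3).over K))) γ₂).Finite)
    (horb₂ : (Set.range fun n : ℕ => ((γ₂ ^ n : ↥(unitaryGroupOfForm σ ((StdForm.antidiagonal 3).over K))) :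
      ↥(unitaryGroupOfForm σ ((StdForm.antidiagonal 3).over K)) ⧸ (glInt 3 K).subgroupOf (unitaryGroupOfForm σ ((StdForm.antidiagonal 3).over K)))).Finite)
    (hloc : ∀ v, ((HermitianLatticeTree.latticeTree σ ϖ ((StdForm.antidiagonal 2).over K)).neighborSet v).Finite)
    (hreg : ∀ v, ((HermitianLatticeTree.latticeTree σ ϖ ((StdForm.antidiagonal 2).over K)).neighborSet v).ncard = q + 1)
    (m : ℕ) :
    (-(q : ℂ)) ^ WithZero.log (Valued.v ((u - A) ^ 2 - C ^ 2 * ρ)) *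
        (({x : {M : Submodule 𝒪[K] (Fin 3 → K) // UnitaryLatticeTree.IsVertex σ ϖ ((StdForm.antidiagonal 3).over K) M} |
              UnitaryLatticeTree.IsSelfDualLattice σ ϖ ((StdForm.antidiagonal 3).over K) x.1 ∧
                (UnitaryLatticeTree.latticeGraph σ ϖ ((StdForm.antidiagonal 3).over K)).dist x
                  (UnitaryLatticeTree.latticeGraphPerm σ ϖ ((StdForm.antidiagonal 3).over K) γ₁ x) = 2 * m}.ncard : ℂ) -
          ({x : {M : Submodule 𝒪[K] (Fin 3 → K) // UnitaryLatticeTree.IsVertex σ ϖ ((StdForm.antidiagonal 3).over K) M} |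
              UnitaryLatticeTree.IsSelfDualLattice σ ϖ ((StdForm.antidiagonal 3).over K) x.1 ∧
                (UnitaryLatticeTree.latticeGraph σ ϖ ((StdForm.antidiagonal 3).over K)).dist x
                  (UnitaryLatticeTree.latticeGraphPerm σ ϖ ((StdForm.antidiagonal 3).over K) γ₂ x) = 2 * m}.ncard : ℂ)) =
      ∑ k ∈ Finset.range (m + 1), xiHCoeff q m k *
          ({x : {M : Submodule (ValuativeRel.valuation K).integer (Fin 2 → K) // HermitianLatticeTree.IsSpecialLattice σ ϖ ((StdForm.antidiagonal 2).over K) M} |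
              HermitianLatticeTree.IsSelfDualLattice σ ((StdForm.antidiagonal 2).over K) x.1 ∧
                (HermitianLatticeTree.latticeTree σ ϖ ((StdForm.antidiagonal 2).over K)).dist x
                  (HermitianLatticeTree.latticeTreeIso σ ϖ ((StdForm.antidiagonal 2).over K) δ x) = 2 * k}.ncard : ℂ) :=
  delta_mul_kappaDiff_ncard_displaced_typeTwo_eq_sum_xiHCoeff_mul_ncard_displaced_two_of_unitLevelOne hd hσO σk hσk hq hfrob hvρ hvC hχ γ₁ hγ₁ γ₂ hγ₂x hx₂ hN₂ hn₂
    δ hδ hy hcW um hum ι hι hιv σR hσR hσι hdRσ hdRu h2R hϖR hιϖ hqR ha₀ g₁ hg₁ hfin₀₁ hfin₁₁ horb₁ hfin₀₂ hfin₁₂ horb₂ hloc hreg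
    (delta_mul_natCard_fixedBy_special_sub_eq_of_typeTwo_deep hd hσO σk hσk hq hfrob hvρ hvC hχ hn2 hN1 γ₁ hγ₁ γ₂ hγ₂x hx₂ hN₂ hn₂ hy hcW um hum ι hι hιv σR hσR hσι
      hdRσ hdRu h2R hϖR hιϖ hqR ha₀ g₁ hg₁ hfin₀₁ hfin₁₁ horb₁ hfin₀₂ hfin₁₂ horb₂) m

end Summit.HodgeConjecture.HodgeConjecture.R90.S6

end
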